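import Summits.KontsevichZagierPeriods.KontsevichZagierPeriods.Theorems.MultiplicationThree.Negative.Pinned
import Literature.NumberTheory.Transcendental.KZSubcalculusInvariants

/-!
# `MultiplicationThree` (stmt-KontsevichZagierPeriods-3598) — negative knowledge, part 7: the transfer
of Terasoma's positive sheet (cdisprove gen 2, cycle 2)

The route's falsifier (2) ("is `[Z₀]` in `ℤ[G]·[γ²]` integrally, or only `N·[Z₀]`?") does NOT bite:
`H₁(C°, cusps; ℤ)` is free of rank one over `ℤ[μ_d × μ_3]` on the real arc (dessin of the Belyi map
`y³`), so the TRANSFER `q^!Z̄₀` (all `2d` sheets) of the positive sheet is `Θ₃·[γ×γ] + ∂W₃ + (chains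
in the cusp divisor)` with the unique explicit `Θ₃ = Σ_{i mod d, j mod 3} ([(i,j)|(−i,j+2)] −
[(i,j)|(−i,j+1)]) ∈ ℤ[(μ_d×μ_3)²]` (paper proof and certificate: Cruxes/MultiplicationThree/
Disproof.lean §7, kit j010553). What is false is the literal uncorrected single-sheet reading of
the crux text: `q` is simply ramified over the barycentre of `Z₀` and the transposition monodromy
obstructs every sum of single-sheet lifts (repairs: the transfer with `η/(2d)`, or a correction chain
`τc − c` along the cusp divisor — both free in the calculus). The small checked anchors of that
analysis are landed here:
* `of_sub_nsmul_of_constMul_inv_mem_relations`, `simplexRep_degree_absorption` — `[r] ≡ k•[r/k]`: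
  the degree `2d` of `q` (O–Y's `(n−1)!`) is absorbed inside rule (1b), no torsion question arises;
* `jacobian_dft_vieta`, `c3_sq` — `∂(σ₁,σ₂)/∂(y₁,y₂) = (ζ−ζ²)(y₁−y₂)`, `(ζ−ζ²)² = −3`;
* `sym_fibre_barycentre`, `ramification_only_at_barycentre` — Vieta's fibre over `σ = (1,1,1)` is the
  double point `y₁ = y₂ = 0`, and `(1,1,1)` is the only point of the closed simplex under the diagonal.
-/

noncomputable section

open MeasureTheory Set Real
open scoped BigOperators

namespace Summit.KontsevichZagierPeriods.TerasomaMultiplication.MultiplicationThreeNegative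

open Literature.NumberTheory.Transcendental
open Literature.NumberTheory.Transcendental.KZ

/-! ## §7 The transfer of the positive sheet: degree absorption and the ramification at the barycentre -/

/-- **Degree absorption** (`[r] ≡ k • [r/k]` modulo the moves, `k ≥ 1`): the transfer of a chain
through a finite map of degree `k` costs nothing in the calculus — O–Y's division by `(n−1)!`, here
`deg q = 2d`, is integrand additivity read backwards. Immediate from the tree's
`KZ.IntegralRep.of_constMul_nat_sub_nsmul_mem_relations`. [folklore] -/
theorem of_sub_nsmul_of_constMul_inv_mem_relations {n : ℕ} (r : IntegralRep n) {k : ℕ}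
    (hk : k ≠ 0) :
    of r - k • of (r.constMul ((k : ℝ)⁻¹) (isAlgebraic_nat k).inv) ∈ relations := by
  set r' := r.constMul ((k : ℝ)⁻¹) (isAlgebraic_nat k).inv with hr'
  have h1 : of (r'.constMul (k : ℝ) (isAlgebraic_nat k)) - k • of r' ∈ relations :=
    r'.of_constMul_nat_sub_nsmul_mem_relations k
  have h2 : of r - of (r'.constMul (k : ℝ) (isAlgebraic_nat k)) ∈ relations := by
    refine of_sub_of_mem_relations_of_eqOn rfl fun x _ => ?_
    have hk' : (k : ℝ) ≠ 0 := Nat.cast_ne_zero.mpr hk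
    simp only [hr', IntegralRep.integrand_constMul]
    field_simp
  have : of r - k • of r' = (of r - of (r'.constMul (k : ℝ) (isAlgebraic_nat k))) +
      (of (r'.constMul (k : ℝ) (isAlgebraic_nat k)) - k • of r') := by abel
  rw [this]
  exact relations.add_mem h2 h1

/-- The crux's pinned simplex representation is `2d` times its `1/(2d)`-scaled copy modulo the
moves (the instance of degree absorption used by the transfer `q^!Z̄₀`). [folklore] -/
theorem simplexRep_degree_absorption {s : ℚ} (hs : 0 < s) {d : ℕ} (hd : d ≠ 0) :
    of (simplexRep s hs) - (2 * d) • of ((simplexRep s hs).constMul (((2 * d : ℕ) : ℝ)⁻¹)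
      (isAlgebraic_nat (2 * d)).inv) ∈ relations :=
  of_sub_nsmul_of_constMul_inv_mem_relations _ (by omega)

open MvPolynomial in
/-- **`c₃ = ζ − ζ²` (`= i√3`): the Jacobian of DFT ∘ Vieta.** For `ζ² + ζ + 1 = 0` and
`σ_j = (1 − ζ^j y₁)(1 − ζ^j y₂)`, `∂(σ₁,σ₂)/∂(y₁,y₂) = (ζ − ζ²)(y₁ − y₂)` as polynomials: the map
ramifies exactly along the diagonal `y₁ = y₂`, and `dσ₁∧dσ₂ = (ζ−ζ²)(y₁−y₂)dy₁∧dy₂`, so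
`q^*η = (ζ−ζ²)(x₁x₂)^{a−d}(y₁−y₂)dy₁∧dy₂` (route dossier; OtsuboYamazaki2026 p. 20). [folklore] -/
theorem jacobian_dft_vieta {R : Type*} [CommRing R] (ζ : R) (hζ : ζ ^ 2 + ζ + 1 = 0) :
    pderiv 0 ((1 - C ζ * X 0) * (1 - C ζ * X 1) : MvPolynomial (Fin 2) R) *
        pderiv 1 ((1 - C (ζ ^ 2) * X 0) * (1 - C (ζ ^ 2) * X 1)) -
      pderiv 1 ((1 - C ζ * X 0) * (1 - C ζ * X 1)) *
        pderiv 0 ((1 - C (ζ ^ 2) * X 0) * (1 - C (ζ ^ 2) * X 1)) =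
      C (ζ - ζ ^ 2) * (X 0 - X 1) := by
  have hζ3 : ζ ^ 3 = 1 := by linear_combination (ζ - 1) * hζ
  have h01 : (0 : Fin 2) ≠ 1 := by decide
  have h10 : (1 : Fin 2) ≠ 0 := by decide
  simp only [Derivation.leibniz, Derivation.map_one_eq_zero, map_sub, pderiv_C,
    pderiv_X_self, pderiv_X_of_ne h01, pderiv_X_of_ne h10, smul_eq_mul, mul_zero, sub_zero,
    mul_one, zero_sub, add_zero, zero_add]
  simp only [map_pow]
  have hC3 : (C ζ : MvPolynomial (Fin 2) R) ^ 3 = 1 := by rw [← C_pow, hζ3, C_1]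
  linear_combination (C ζ - C ζ ^ 2) * (X 0 - X 1 : MvPolynomial (Fin 2) R) * hC3

/-- `c₃² = −3`: the square of the Jacobian constant; this is why the inverse character transform
`(1/3)(ζ−ζ²)(ζ^δ − ζ^{−δ})` of `Θ̂₃` takes the INTEGER values `0, −1, +1` (`δ = 0, 1, 2`). [folklore] -/
theorem c3_sq {R : Type*} [CommRing R] (ζ : R) (hζ : ζ ^ 2 + ζ + 1 = 0) :
    (ζ - ζ ^ 2) ^ 2 = -3 ∧ (ζ - ζ ^ 2) * (ζ ^ 2 - ζ) = 3 := by
  constructor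
  · linear_combination (ζ ^ 2 - 3 * ζ + 3) * hζ
  · linear_combination -(ζ ^ 2 - 3 * ζ + 3) * hζ

/-- **The fibre of Vieta over the barycentre is the double point `y₁ = y₂ = 0`** (any field of
characteristic `≠ 3` with a primitive cube root `ζ`): `σ₀ = σ₁ = σ₂ = 1` iff `y₁ = y₂ = 0`. So `q`
is (simply) ramified over the INTERIOR point `b = (1,1,1)` of `Z₀`: the local monodromy is a
transposition, the source of O–Y's `(n−1)! = 2` and of Paper Theorem 7.2. (Two of the three equations
suffice.) [folklore] -/
theorem sym_fibre_barycentre {K : Type*} [Field K] (ζ : K) (hζ : ζ ^ 2 + ζ + 1 = 0)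
    (h3 : (3 : K) ≠ 0) (y₁ y₂ : K) :
    ((1 - y₁) * (1 - y₂) = 1 ∧ (1 - ζ * y₁) * (1 - ζ * y₂) = 1 ∧
      (1 - ζ ^ 2 * y₁) * (1 - ζ ^ 2 * y₂) = 1) ↔ (y₁ = 0 ∧ y₂ = 0) := by
  constructor
  · rintro ⟨h0, h1, -⟩
    have key : (ζ ^ 2 - ζ) * (y₁ + y₂) = 0 := by linear_combination h1 - ζ ^ 2 * h0
    have hsq : (ζ ^ 2 - ζ) ^ 2 = -3 := by linear_combination (ζ ^ 2 - 3 * ζ + 3) * hζ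
    have hne : ζ ^ 2 - ζ ≠ 0 := by
      intro h
      rw [h] at hsq
      exact h3 (by linear_combination hsq)
    have hsum : y₁ + y₂ = 0 := (mul_eq_zero.mp key).resolve_left hne
    have hprod : y₁ * y₂ = 0 := by linear_combination h0 + hsum
    have hy2 : y₂ = -y₁ := by linear_combination hsum
    have hy1 : y₁ ^ 2 = 0 := by rw [hy2] at hprod; linear_combination -hprod
    have : y₁ = 0 := pow_eq_zero_iff (n := 2) (by norm_num) |>.mp hy1
    exact ⟨this, by rw [hy2, this, neg_zero]⟩
  · rintro ⟨rfl, rfl⟩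
    refine ⟨by ring, by ring, by ring⟩

/-- **`b` is the only ramification point of Vieta over the CLOSED simplex.** Real points of `S` are
`e₂ = −ē₁`; writing `e₁ = u + iv`, `σ₀ = 1 − 2u`, `σ₁ = 1 + u + √3 v`, `σ₂ = 1 + u − √3 v`, and the
discriminant of `y² − e₁y + e₂` is `e₁² + 4ē₁ = (u² − v² + 4u) + i(2uv − 4v)`. On `Δ̄ = {σ_j ≥ 0}`
it vanishes only at `u = v = 0`, i.e. at `σ = (1,1,1)` (the other zeros `e₁ = −4, 4e^{±iπ/3}` have
a negative `σ_j`; the hypothesis `σ₂ ≥ 0` is not even needed). Hence `q⁻¹(Δ̄ ∖ {b}) → Δ̄ ∖ {b}` is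
unramified in the `y`-variables and the only interior monodromy of `q` over `Z₀` is the transposition
at `b`. [folklore] -/
theorem ramification_only_at_barycentre (u v : ℝ) (h₀ : 0 ≤ 1 - 2 * u)
    (h₁ : 0 ≤ 1 + u + Real.sqrt 3 * v)
    (hre : u ^ 2 - v ^ 2 + 4 * u = 0) (him : v * (2 * u - 4) = 0) : u = 0 ∧ v = 0 := by
  rcases mul_eq_zero.mp him with hv | hu
  · subst hv
    have hu : u * (u + 4) = 0 := by linear_combination hre
    rcases mul_eq_zero.mp hu with hu | hu
    · exact ⟨hu, rfl⟩
    · exfalso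
      have : u = -4 := by linear_combination hu
      rw [this] at h₁
      norm_num at h₁
  · exfalso
    have : u = 2 := by linear_combination hu / 2
    rw [this] at h₀
    norm_num at h₀

end Summit.KontsevichZagierPeriods.TerasomaMultiplication.MultiplicationThreeNegative
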